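import Summits.SmoothPoincare4.SmoothPoincare4.Theorems.EntropyRungCompactShrinkerGapLogSobolev
import Literature.Geometry.Riemannian.GradientShrinkerProofs
import Literature.Geometry.Riemannian.BakryEmeryHeatFlow
import HarnessLib

/-!
# Perelman's entropy of a closed gradient shrinker is minimised by the potential
(line `cgy-variance-pivot`, crux `EntropyRung.CompactShrinkerGap`, item stmt-SmoothPoincare4-10870;
registered helper `helper_entropyTestInequality`)

For a Riemannian metric `g` (Levi-Civita connection) on a closed `4`-manifold `M ≃ₕ S⁴` and a
smooth `f` with `Ric + Hess f = g/2`, `R + |∇f|² = f` (a normalised gradient shrinker, `τ = 1`),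
Perelman's entropy at scale `1` tested on the density `u ∝ e^{-ψ}` dominates `log Θ`,
`Θ ∝ Z = ∫ e^{-f} dV` (Carrillo–Ni: the shrinker potential minimises `𝒲(g, ·, 1)`). Multiplied
through by `A = ∫ e^{-ψ} dV > 0` this is the registered typing

  `A · log (Z / A) ≤ ∫ (R + |∇ψ|² + ψ − 4) e^{-ψ} dV`     for every smooth `ψ`.

Proof: the log-Sobolev inequality of the shrinker (`helper_shrinkerLogSobolev`, Bakry–Émery with
`K = ½`) at `h = f − ψ` (`e^{h − f} = e^{-ψ}`) reads
`∫ (f − ψ) e^{-ψ} − A log (A/Z) ≤ ∫ |∇(f − ψ)|² e^{-ψ}`; expand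
`|∇(f − ψ)|² = |∇f|² − 2 g⁻¹(df, dψ) + |∇ψ|²` (`gradSq_sub`), trade the cross term by Green's first
identity `∫ g⁻¹(df, dψ) e^{-ψ} = −∫ g⁻¹(d e^{-ψ}, df) = ∫ e^{-ψ} Δf`
(`integral_mul_dalembertian_riemVolume`, `d e^{-ψ} = −e^{-ψ} dψ`), and use the trace `Δf = 2 − R`
of the soliton equation and the normalisation `|∇f|² − f = −R`; finally `log (Z/A) = −log (A/Z)`.
Sanity check: `ψ = f` gives equality (`∫ (2f − 4) e^{-f} = 2∫ Δ e^{-f} = 0`).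

References: G. Perelman, arXiv:math/0211159, §3; J. A. Carrillo, L. Ni, Comm. Anal. Geom. 17
(2009), Thm. 1.1 (ii), §4 and Cor. 4.1; J. M. Lee, *Introduction to Riemannian Manifolds* (2018),
Problem 2-23.
-/

noncomputable section

-- the registered namespace `Summit.SmoothPoincare4.SmoothPoincare4.Theorems` repeats a component
set_option linter.dupNamespace false

open MeasureTheory Set Function Filter Module
open scoped Manifold ContDiff ENNReal Topology ContinuousMap

namespace Summit.SmoothPoincare4.SmoothPoincare4.Theorems

open Literature.Geometry Literature.Geometry.Lorentzian Literature.Geometry.Riemannian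
  Literature.Geometry.Lorentzian.PseudoRiemannianMetric

/-- **Registered helper `helper_entropyTestInequality` of line `cgy-variance-pivot`** — the shrinker
potential minimises Perelman's entropy at scale `1`: for `M ≃ₕ S⁴` closed, `g` Riemannian
(Levi-Civita), `f` smooth with `Ric + Hess f = g/2` and `R + |∇f|² = f`, and every smooth `ψ`,
`(∫ e^{-ψ}) · log (∫ e^{-f} / ∫ e^{-ψ}) ≤ ∫ (R + |∇ψ|² + ψ − 4) e^{-ψ}` (all integrals `dV_g`), i.e.
`log Θ ≤ 𝒲(g, ψ, 1)` multiplied through by `∫ e^{-ψ} > 0`. Proof: the log-Sobolev inequality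
`helper_shrinkerLogSobolev` at `h = f − ψ`, the expansion
`|∇(f − ψ)|² = |∇f|² − 2 g⁻¹(df, dψ) + |∇ψ|²`, Green's first identity
`∫ g⁻¹(df, dψ) e^{-ψ} = ∫ e^{-ψ} Δf` and the pointwise identities `Δf = 2 − R`, `|∇f|² − f = −R`.
[cite: CarrilloNi2009, Thm. 1.1 (ii), §4 and Cor. 4.1] [cite: Perelman2002Entropy, §3]
[cite: Lee2018, Problem 2-23 (a)] -/
theorem helper_entropyTestInequality :
    ∀ (M : Type) [TopologicalSpace M] [T2Space M] [SecondCountableTopology M]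
      [ChartedSpace (EuclideanSpace ℝ (Fin 4)) M] [IsManifold (𝓡 4) ∞ M] [CompactSpace M]
      [T3Space M] [MeasurableSpace M] [BorelSpace M],
      M ≃ₕ Metric.sphere (0 : EuclideanSpace ℝ (Fin 5)) 1 →
    ∀ (g : Literature.Geometry.Lorentzian.PseudoRiemannianMetric (𝓡 4) ∞ (EuclideanSpace ℝ (Fin 4))
        (TangentSpace (𝓡 4) : M → Type _)) [g.HasLeviCivita] (f : M → ℝ) (hg : g.IsRiemannian),
      ContMDiff (𝓡 4) 𝓘(ℝ, ℝ) ∞ f →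
      (∀ (x : M) (X Y : TangentSpace (𝓡 4) x),
        g.ricci x X Y + g.hessian f x X Y = (1 / 2 : ℝ) * g.val x X Y) →
      (∀ x : M, g.scalarCurvature x + g.gradSq f x = f x) →
      ∀ (ψ : M → ℝ), ContMDiff (𝓡 4) 𝓘(ℝ, ℝ) ∞ ψ →
      (∫ x, Real.exp (-ψ x)
          ∂(Literature.Geometry.Lorentzian.riemannianMeasure (g.toContMDiffRiemannianMetric hg))) *
          Real.log ((∫ x, Real.exp (-f x)
              ∂(Literature.Geometry.Lorentzian.riemannianMeasure
                (g.toContMDiffRiemannianMetric hg))) /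
            (∫ x, Real.exp (-ψ x)
              ∂(Literature.Geometry.Lorentzian.riemannianMeasure
                (g.toContMDiffRiemannianMetric hg)))) ≤
        ∫ x, (g.scalarCurvature x + g.gradSq ψ x + ψ x - 4) * Real.exp (-ψ x)
          ∂(Literature.Geometry.Lorentzian.riemannianMeasure
            (g.toContMDiffRiemannianMetric hg)) := by
  intro M _ _ _ _ _ _ _ _ _ e g _ f hg hf hsol hnorm ψ hψ
  -- the log-Sobolev inequality of the shrinker at `h = f − ψ`, where `e^{h − f} = e^{−ψ}`
  have hLSI := helper_shrinkerLogSobolev M e g f hg hf hsol (f - ψ) (hf.sub hψ)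
  simp only [Pi.sub_apply, sub_sub_cancel_left] at hLSI
  -- the Riemannian measure is `g.riemVolume`
  have hV : g.riemVolume = riemannianMeasure (g.toContMDiffRiemannianMetric hg) :=
    PseudoRiemannianMetric.riemVolume_eq hg
  rw [← hV] at hLSI ⊢
  -- the two masses and `log (Z/A) = −log (A/Z)`
  set A : ℝ := ∫ x, Real.exp (-ψ x) ∂g.riemVolume with hA
  set Z : ℝ := ∫ x, Real.exp (-f x) ∂g.riemVolume with hZ
  have hlog : Real.log (Z / A) = -Real.log (A / Z) := by
    rw [← Real.log_inv, inv_div]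
  rw [hlog]
  -- the hypotheses say `(g, f, 1)` is a normalised gradient shrinker; `Δf = 2 − R`
  have h : g.IsNormalisedShrinker f 1 := (g.isNormalisedShrinker_one_iff f).2 ⟨hsol, hnorm⟩
  have hE : finrank ℝ (EuclideanSpace ℝ (Fin 4)) = 4 := finrank_euclideanSpace_fin
  have hΔ : ∀ x, g.dalembertian f x = 2 - g.scalarCurvature x := fun x ↦ by
    have h1 := h.1.scalarCurvature_add_dalembertian_one x
    rw [hE] at h1
    push_cast at h1
    linarith
  -- regularity and continuity of the integrands
  have hf1 : ContMDiff (𝓡 4) 𝓘(ℝ, ℝ) 1 f := hf.of_le (by norm_num)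
  have hf2 : ContMDiff (𝓡 4) 𝓘(ℝ, ℝ) 2 f := hf.of_le (WithTop.coe_le_coe.mpr le_top)
  have hψ1 : ContMDiff (𝓡 4) 𝓘(ℝ, ℝ) 1 ψ := hψ.of_le (by norm_num)
  have hfψ1 : ContMDiff (𝓡 4) 𝓘(ℝ, ℝ) 1 (f - ψ) := hf1.sub hψ1
  have hus : ContMDiff (𝓡 4) 𝓘(ℝ, ℝ) ∞ (fun y ↦ Real.exp (-ψ y)) :=
    Real.contDiff_exp.comp_contMDiff hψ.neg
  have hu1 : ContMDiff (𝓡 4) 𝓘(ℝ, ℝ) 1 (fun y ↦ Real.exp (-ψ y)) := hus.of_le (by norm_num)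
  have huc : Continuous fun y ↦ Real.exp (-ψ y) := hus.continuous
  have hSc : Continuous g.scalarCurvature := (contMDiff_scalarCurvature g).continuous
  have hΔc : Continuous (g.dalembertian f) := continuous_dalembertian g hf2
  have hGψ : Continuous (g.gradSq ψ) := continuous_innerDual_mvfderiv g hψ1 hψ1
  have hGfψ : Continuous (g.gradSq (f - ψ)) := continuous_innerDual_mvfderiv g hfψ1 hfψ1
  have hIc : Continuous fun x ↦ g.innerDual x
      (mvfderiv (𝓡 4) f x : TangentSpace (𝓡 4) x →ₗ[ℝ] ℝ)
      (mvfderiv (𝓡 4) ψ x : TangentSpace (𝓡 4) x →ₗ[ℝ] ℝ) :=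
    continuous_innerDual_mvfderiv g hf1 hψ1
  -- pointwise: `|∇(f − ψ)|² = |∇f|² − 2 g⁻¹(df, dψ) + |∇ψ|²`
  have hgrad : ∀ x, g.gradSq (f - ψ) x = g.gradSq f x
      - 2 * g.innerDual x (mvfderiv (𝓡 4) f x : TangentSpace (𝓡 4) x →ₗ[ℝ] ℝ)
          (mvfderiv (𝓡 4) ψ x : TangentSpace (𝓡 4) x →ₗ[ℝ] ℝ) + g.gradSq ψ x := fun x ↦
    g.gradSq_sub (hf.mdifferentiableAt (by norm_num)) (hψ.mdifferentiableAt (by norm_num))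
  -- the cross term by Green's first identity: `∫ g⁻¹(df, dψ) e^{-ψ} = ∫ e^{-ψ} Δf`
  have hcross : ∫ x, g.innerDual x (mvfderiv (𝓡 4) f x : TangentSpace (𝓡 4) x →ₗ[ℝ] ℝ)
      (mvfderiv (𝓡 4) ψ x : TangentSpace (𝓡 4) x →ₗ[ℝ] ℝ) * Real.exp (-ψ x) ∂g.riemVolume =
      ∫ x, Real.exp (-ψ x) * g.dalembertian f x ∂g.riemVolume := by
    rw [integral_mul_dalembertian_riemVolume g hg hu1 hf2, ← integral_neg]
    refine integral_congr_ae (Eventually.of_forall fun x ↦ ?_)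
    have hψd : MDifferentiableAt (𝓡 4) 𝓘(ℝ, ℝ) ψ x := hψ.mdifferentiableAt (by norm_num)
    beta_reduce
    rw [mvfderiv_exp_neg_toLinearMap hψd, g.innerDual_smul_left,
      g.innerDual_comm x (mvfderiv (𝓡 4) f x : TangentSpace (𝓡 4) x →ₗ[ℝ] ℝ)
        (mvfderiv (𝓡 4) ψ x : TangentSpace (𝓡 4) x →ₗ[ℝ] ℝ)]
    ring
  -- pointwise rearrangement (`Δf = 2 − R`, `R + |∇f|² = f`)
  have hpt : ∀ x, g.gradSq (f - ψ) x * Real.exp (-ψ x) - (f x - ψ x) * Real.exp (-ψ x) =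
      (g.scalarCurvature x + g.gradSq ψ x + ψ x - 4) * Real.exp (-ψ x)
        - 2 * (g.innerDual x (mvfderiv (𝓡 4) f x : TangentSpace (𝓡 4) x →ₗ[ℝ] ℝ)
            (mvfderiv (𝓡 4) ψ x : TangentSpace (𝓡 4) x →ₗ[ℝ] ℝ) * Real.exp (-ψ x)
          - Real.exp (-ψ x) * g.dalembertian f x) := by
    intro x
    rw [hgrad x, hΔ x]
    linear_combination (Real.exp (-ψ x)) * hnorm x
  -- integrability of everything in sight (continuous functions on a compact manifold)
  have iG : Integrable (fun x ↦ g.gradSq (f - ψ) x * Real.exp (-ψ x)) g.riemVolume :=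
    g.integrable_of_continuous (hGfψ.mul huc)
  have iφ : Integrable (fun x ↦ (f x - ψ x) * Real.exp (-ψ x)) g.riemVolume :=
    g.integrable_of_continuous ((hf.continuous.sub hψ.continuous).mul huc)
  have iW : Integrable (fun x ↦ (g.scalarCurvature x + g.gradSq ψ x + ψ x - 4) * Real.exp (-ψ x))
      g.riemVolume :=
    g.integrable_of_continuous ((((hSc.add hGψ).add hψ.continuous).sub continuous_const).mul huc)
  have iI : Integrable (fun x ↦ g.innerDual x (mvfderiv (𝓡 4) f x : TangentSpace (𝓡 4) x →ₗ[ℝ] ℝ)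
      (mvfderiv (𝓡 4) ψ x : TangentSpace (𝓡 4) x →ₗ[ℝ] ℝ) * Real.exp (-ψ x)) g.riemVolume :=
    g.integrable_of_continuous (hIc.mul huc)
  have iΔ : Integrable (fun x ↦ Real.exp (-ψ x) * g.dalembertian f x) g.riemVolume :=
    g.integrable_of_continuous (huc.mul hΔc)
  -- integrate the rearrangement
  have s1 : ∫ x, g.gradSq (f - ψ) x * Real.exp (-ψ x) ∂g.riemVolume
      - ∫ x, (f x - ψ x) * Real.exp (-ψ x) ∂g.riemVolume =
      ∫ x, (g.gradSq (f - ψ) x * Real.exp (-ψ x) - (f x - ψ x) * Real.exp (-ψ x))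
        ∂g.riemVolume := (integral_sub iG iφ).symm
  have s2 : ∫ x, (g.gradSq (f - ψ) x * Real.exp (-ψ x) - (f x - ψ x) * Real.exp (-ψ x))
        ∂g.riemVolume =
      ∫ x, ((g.scalarCurvature x + g.gradSq ψ x + ψ x - 4) * Real.exp (-ψ x)
        - 2 * (g.innerDual x (mvfderiv (𝓡 4) f x : TangentSpace (𝓡 4) x →ₗ[ℝ] ℝ)
            (mvfderiv (𝓡 4) ψ x : TangentSpace (𝓡 4) x →ₗ[ℝ] ℝ) * Real.exp (-ψ x)
          - Real.exp (-ψ x) * g.dalembertian f x)) ∂g.riemVolume :=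
    integral_congr_ae (Eventually.of_forall hpt)
  have e1 : ∫ x, ((g.scalarCurvature x + g.gradSq ψ x + ψ x - 4) * Real.exp (-ψ x)
        - 2 * (g.innerDual x (mvfderiv (𝓡 4) f x : TangentSpace (𝓡 4) x →ₗ[ℝ] ℝ)
            (mvfderiv (𝓡 4) ψ x : TangentSpace (𝓡 4) x →ₗ[ℝ] ℝ) * Real.exp (-ψ x)
          - Real.exp (-ψ x) * g.dalembertian f x)) ∂g.riemVolume =
      ∫ x, (g.scalarCurvature x + g.gradSq ψ x + ψ x - 4) * Real.exp (-ψ x) ∂g.riemVolume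
      - ∫ x, 2 * (g.innerDual x (mvfderiv (𝓡 4) f x : TangentSpace (𝓡 4) x →ₗ[ℝ] ℝ)
            (mvfderiv (𝓡 4) ψ x : TangentSpace (𝓡 4) x →ₗ[ℝ] ℝ) * Real.exp (-ψ x)
          - Real.exp (-ψ x) * g.dalembertian f x) ∂g.riemVolume :=
    integral_sub iW ((iI.sub' iΔ).const_mul 2)
  have e4 : ∫ x, 2 * (g.innerDual x (mvfderiv (𝓡 4) f x : TangentSpace (𝓡 4) x →ₗ[ℝ] ℝ)
            (mvfderiv (𝓡 4) ψ x : TangentSpace (𝓡 4) x →ₗ[ℝ] ℝ) * Real.exp (-ψ x)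
          - Real.exp (-ψ x) * g.dalembertian f x) ∂g.riemVolume =
      2 * ∫ x, (g.innerDual x (mvfderiv (𝓡 4) f x : TangentSpace (𝓡 4) x →ₗ[ℝ] ℝ)
            (mvfderiv (𝓡 4) ψ x : TangentSpace (𝓡 4) x →ₗ[ℝ] ℝ) * Real.exp (-ψ x)
          - Real.exp (-ψ x) * g.dalembertian f x) ∂g.riemVolume :=
    integral_const_mul 2 _
  have e5 : ∫ x, (g.innerDual x (mvfderiv (𝓡 4) f x : TangentSpace (𝓡 4) x →ₗ[ℝ] ℝ)
            (mvfderiv (𝓡 4) ψ x : TangentSpace (𝓡 4) x →ₗ[ℝ] ℝ) * Real.exp (-ψ x)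
          - Real.exp (-ψ x) * g.dalembertian f x) ∂g.riemVolume =
      ∫ x, g.innerDual x (mvfderiv (𝓡 4) f x : TangentSpace (𝓡 4) x →ₗ[ℝ] ℝ)
            (mvfderiv (𝓡 4) ψ x : TangentSpace (𝓡 4) x →ₗ[ℝ] ℝ) * Real.exp (-ψ x)
          ∂g.riemVolume
      - ∫ x, Real.exp (-ψ x) * g.dalembertian f x ∂g.riemVolume :=
    integral_sub iI iΔ
  linarith [hLSI, s1, s2, e1, e4, e5, hcross]

end Summit.SmoothPoincare4.SmoothPoincare4.Theorems

end
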